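import Mathlib
import HarnessLib
import Summits.HubbardSuperconductivity.HubbardSuperconductivity.Theorems.KLProgrammeKLRegimeVolumeLimitFlowFramesV17F2
import Summits.HubbardSuperconductivity.HubbardSuperconductivity.Theorems.KLProgrammeKLRegimeTwoVolumeSourceProfileDefs

/-!
# Route `KLProgramme` — crux K3, VL child `KLRegimeVolumeLimitV17F2` (stmt-HubbardSuperconductivity-20440): THE «SRC-DEG2» PRODUCER TEXT (candidate v11a)
# IMPLIES THE v10 PRODUCER TEXT (seat hubbard-kl-k3c4-p1 g14; bridge lemma, `--supports` 20440)

Located note «SRC-DEG2» (k3c4-p1 g14, `…TowerScaleSmallNecessary`): the volume-free smallness (H3) of `TowerDataT` forces the DEGREE-2 profile budgets of every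
step to carry the scale law (`e⁵·aW j·NV j 1 < 1`), so the v10 producer text of token #24 — budget `klSrcBudget P Q' U A (j+1) s m = A (j+1) s · (if m ≤ 2 then 1
else klWtBudget P Q' U (j+1) m)` with `A` FREE — does not let the consumer discharge (H3).  Cure (α) is the one-line text change "the degree-`≤ 2` source families
get (b)'s law too": budget `fun _ m => Q'.CE · klWtBudget P Q' U (j+1) m`, no free prefactor.  This file proves that the (α) text IMPLIES the v10 text (with
`A j s := Q'.CE · max 1 (max W_j(0) (max W_j(1) W_j(2)))`), so the v10 closer `stub_vl_nestedFramed_of_towerDataT_lev` and the END extraction keep applying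
verbatim under (α):

* `sourceProfilesAtLev_klSrcBudget_of_wtBudgetLaw` — per instance;
* **`srcProfilesTextV10_of_v11a`** — the ∃-packaged texts.

Proofs only; no definition; nothing asserts either text. [cite: BenfattoGiulianiMastropietro2006, §2.5 (2.52)–(2.55)]
-/

noncomputable section

namespace Summit.HubbardSuperconductivity.HubbardSuperconductivity.Theorems.TwoVolumeSource

set_option linter.dupNamespace false -- summit = problem name (single-conjunct summit), D-0017

open Finset Filter Topology Literature.MathematicalPhysics.QuantumLattice Literature.Probability.LatticeModels
open Summit.HubbardSuperconductivity.HubbardSuperconductivity.Theorems.KLProgrammeLegKernels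
open Summit.HubbardSuperconductivity.HubbardSuperconductivity.Theorems.KLRegimeSplit
open Summit.HubbardSuperconductivity.HubbardSuperconductivity.Theorems.EngineV8
open Summit.HubbardSuperconductivity.HubbardSuperconductivity.Theorems.TwoPointAssembly

/-- **The all-degree law budget is below a `klSrcBudget` with the prefactor `CE · max(1, W_j(0), W_j(1), W_j(2))`.** [folklore] -/
theorem sourceProfilesAtLev_klSrcBudget_of_wtBudgetLaw {L M : ℕ} [NeZero L] [NeZero M] {P : SplitConsts} {Q : EngConsts} (hCE : 0 ≤ Q.CE)
    (hK : 0 ≤ P.Klam) {U β μ : ℝ} {K : TrigPolyC4v} {J r n : ℕ} (j : ℕ)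
    (h : SourceProfilesAtLev L M (fun _ m => Q.CE * klWtBudget P Q U j m) β U μ K J r n) :
    SourceProfilesAtLev L M (klSrcBudget P Q U
      (fun j _ => Q.CE * max 1 (max (klWtBudget P Q U j 0) (max (klWtBudget P Q U j 1) (klWtBudget P Q U j 2)))) j) β U μ K J r n := by
  refine h.mono fun s m => ?_
  by_cases hm : m ≤ 2
  · rw [klSrcBudget_of_le_two P Q U _ j s hm]
    refine mul_le_mul_of_nonneg_left ?_ hCE
    interval_cases m
    · exact le_max_of_le_right (le_max_left _ _)
    · exact le_max_of_le_right (le_max_of_le_right (le_max_left _ _))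
    · exact le_max_of_le_right (le_max_of_le_right (le_max_right _ _))
  · rw [klSrcBudget_of_two_lt P Q U _ j s (not_le.1 hm)]
    exact mul_le_mul_of_nonneg_right (le_mul_of_one_le_right hCE (le_max_left _ _)) (klWtBudget_nonneg hCE hK U j m)

/-- **THE (α) PRODUCER TEXT (v11a candidate) IMPLIES THE v10 PRODUCER TEXT** (see the module docstring). [folklore] -/
theorem srcProfilesTextV10_of_v11a
    (h : ∀ (P : SplitConsts) (R : RenConsts), P.WF → R.WF2 →
      ∃ Q' : EngConsts, 0 ≤ Q'.CE ∧ ∃ c₀ : ℝ, 0 < c₀ ∧ ∀ c : ℝ, 0 < c → c ≤ c₀ → ∃ U₀ : ℝ, 0 < U₀ ∧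
        ∀ μ ∈ klWindowC, ∀ U : ℝ, 0 < U → U ≤ U₀ → ∀ β : ℝ, klBetaMin ≤ β → β ≤ Real.exp (c / U ^ 2) →
          ∃ L₁ : ℕ, ∃ M₁ : ℕ → ℕ, ∀ (L M : ℕ) [NeZero L] [NeZero M], L₁ ≤ L → M₁ L ≤ M →
            ∀ j : ℕ, j + 1 ≤ nScales β + 1 →
              SourceProfilesAtLev L M (fun _ m => Q'.CE * klWtBudget P Q' U (j + 1) m) β U μ (klFlowFrameU L M β U μ (nScales β + 1)) j j (j + 1)) :
    ∀ (P : SplitConsts) (R : RenConsts), P.WF → R.WF2 →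
      ∃ Q' : EngConsts, 0 ≤ Q'.CE ∧ ∃ c₀ : ℝ, 0 < c₀ ∧ ∀ c : ℝ, 0 < c → c ≤ c₀ → ∃ U₀ : ℝ, 0 < U₀ ∧
        ∀ μ ∈ klWindowC, ∀ U : ℝ, 0 < U → U ≤ U₀ → ∀ β : ℝ, klBetaMin ≤ β → β ≤ Real.exp (c / U ^ 2) →
          ∃ A : ℕ → ℕ → ℝ, ∃ L₁ : ℕ, ∃ M₁ : ℕ → ℕ, ∀ (L M : ℕ) [NeZero L] [NeZero M], L₁ ≤ L → M₁ L ≤ M →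
            ∀ j : ℕ, j + 1 ≤ nScales β + 1 →
              SourceProfilesAtLev L M (klSrcBudget P Q' U A (j + 1)) β U μ (klFlowFrameU L M β U μ (nScales β + 1)) j j (j + 1) := by
  intro P R hP hR
  obtain ⟨Q', hCE, c₀, hc₀, hc⟩ := h P R hP hR
  refine ⟨Q', hCE, c₀, hc₀, fun c hc0 hcc => ?_⟩
  obtain ⟨U₀, hU₀, hU⟩ := hc c hc0 hcc
  refine ⟨U₀, hU₀, fun μ hμ U hU0 hUU β hβ hβc => ?_⟩
  obtain ⟨L₁, M₁, hLM⟩ := hU μ hμ U hU0 hUU β hβ hβc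
  refine ⟨fun j _ => Q'.CE * max 1 (max (klWtBudget P Q' U j 0) (max (klWtBudget P Q' U j 1) (klWtBudget P Q' U j 2))), L₁, M₁,
    fun L M _ _ hL hM j hj => ?_⟩
  exact sourceProfilesAtLev_klSrcBudget_of_wtBudgetLaw hCE (le_trans zero_le_one hP.1) (j + 1) (hLM L M hL hM j hj)

end Summit.HubbardSuperconductivity.HubbardSuperconductivity.Theorems.TwoVolumeSource

end
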